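import Literature.AlgebraicGeometry.Frobenioids.PerfectionGpRoots
import Literature.AlgebraicGeometry.Frobenioids.PerfectionRoots
import Literature.AlgebraicGeometry.Frobenioids.ModelFrobenioidRootFunctors
import HarnessLib

/-!
# Frobenioids I, Prop. 5.5 (iv): the perfected divisor datum `Div_B^pf : B^pf → (Φ^gp)^pf = (Φ^pf)^gp` EXISTS

Mochizuki, *The geometry of Frobenioids I: the general theory*, Kyushu J. Math. **62** (2008) 293–400, §5,
Proposition 5.5 (iv) p. 104 ll. 40–44 (kurims render; the two «…» mark OUR elisions of the "respectively"
clauses, the square brackets are print's): "If `C` is the model Frobenioid associated to data `Φ, B, Div_B : B → Φ^gp`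
[cf. Theorem 5.2, (ii)], then there is a natural equivalence of categories [compatible with the functors to the
respective elementary Frobenioids] between `C^pf` «…» and the model Frobenioid associated to the data
`Φ^pf, B^pf, B^pf → (Φ^gp)^pf` «…»" — in this file (not print's wording) the homomorphism `B^pf → (Φ^gp)^pf` is
read as the perfection of `Div_B : B → Φ^gp` followed by the identification `(Φ^gp)^pf = (Φ^pf)^gp`
[cite: MochizukiFrdI2008, Prop. 5.5 (iv) p.104]; §0 p. 11 (perfections and groupifications of commutative
monoids) [cite: MochizukiFrdI2008, §0 p.11].  (v2 = DOCSTRING-ONLY repair of referee finding C13-F2, quote-voice;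
declarations byte-identical to v1.)

PROOF-ONLY (seat abc-iut-L1-d5 gen 4; cell abc-iut, L1).  abc-iut-L1-t5 typed the perfected datum as a BINDER:
a natural transformation `DivBpf : B^pf ⟶ (Φ^pf)^gp` subject to the compatibility `IsPerfectedDiv Φ B Div_B DivBpf`
(`Div_B^pf ∘ (B → B^pf) = ((Φ → Φ^pf)^gp) ∘ Div_B`), consumed by the Prop. 5.5 (iv) files
(`PerfectionModelFunctor/Full/Equivalence`, `ModelFrobenioidRootFunctors`, `Prop55ivPfFunctor`) and by the Prop. 5.3
row P53/L04 (`UnitTrivializationPerfectionModel`), with NO producer in the tree.  This file constructs it for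
ANY model data with `Φ` integral objectwise (so that roots are unique in `(Φ^pf)^gp`):

* `Perfection.hom_ext_gpPerfection` — two homomorphisms `M^pf → (N^pf)^gp` (`N` integral) that agree on `M` are
  equal (`x^n ∈ M` for `x = a^{1/n}` and `n`-th roots are unique);
* **`exists_isPerfectedDiv`** — `∃ DivBpf, IsPerfectedDiv Φ B Div_B DivBpf`: at `A`, the composite
  `B(A)^pf → ((Φ^pf(A))^gp)^pf ≃ (Φ^pf(A))^gp` of the perfection of `(Φ → Φ^pf)^gp ∘ Div_B` with the inverse of
  `P → P^pf` for the PERFECT group `P = (Φ^pf(A))^gp` (`isPerfect_gpPerfection`, `isPerfect_iff_bijective_of`);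
  naturality in `A` by `hom_ext_gpPerfection`;
* `isPerfectedDiv_unique` — and it is UNIQUE (same extensionality; the compatibility componentwise is
  abc-iut-w5-d120's `ModelFrobenioid.divB_toPerfectionFunctor`), so the binder of the consumers names a well-defined object.

No definitions (the datum is produced inside `∃`); no statement of the paper is re-typed; nothing here bears on
[IUTchIII] Cor. 3.12.
-/

namespace Literature.AlgebraicGeometry.Frobenioids

open CategoryTheory Opposite Function

universe w v u

namespace Perfection

variable {M N : Type w} [CommMonoid M] [CommMonoid N]

/-- **Extensionality into `(N^pf)^gp`** (`N` integral): homomorphisms `M^pf → (N^pf)^gp` agreeing on `M` are equal —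
for `x = a^{1/n}` one has `xⁿ = a ∈ M`, and `n`-th roots are unique in `(N^pf)^gp` (`gp_pow_injective`).
[cite: MochizukiFrdI2008, §0 p.11] -/
theorem hom_ext_gpPerfection [IsCancelMul N] {g₁ g₂ : Perfection M →* Algebra.GrothendieckGroup (Perfection N)}
    (h : ∀ a : M, g₁ (of M a) = g₂ (of M a)) : g₁ = g₂ := by
  ext x
  obtain ⟨⟨a, n⟩, rfl⟩ := mk_surjective x
  apply gp_pow_injective n
  change g₁ (mk a n) ^ (n : ℕ) = g₂ (mk a n) ^ (n : ℕ)
  rw [← map_pow, ← map_pow, mk_pow_self, h]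

end Perfection

section ModelData

variable {D : Type u} [Category.{v} D] {Φ B : Dᵒᵖ ⥤ CommMonCat.{w}} (DivB : B ⟶ monoidGp Φ)

/-- **The perfected divisor datum exists** (Prop. 5.5 (iv): "`B^pf → (Φ^gp)^pf`" `= (Φ^pf)^gp`), for `Φ` integral
objectwise: a natural transformation `Div_B^pf : B^pf ⟶ (Φ^pf)^gp` with `Div_B^pf(ι u) = ι^gp(Div_B u)`
(abc-iut-L1-t5's `IsPerfectedDiv`).  At `A` it is the perfection of `ι^gp ∘ Div_B : B(A) → (Φ^pf(A))^gp` followed by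
the inverse of the bijection `P → P^pf` of the perfect group `P = (Φ^pf(A))^gp`.
[cite: MochizukiFrdI2008, Prop. 5.5 (iv) p.104] -/
theorem exists_isPerfectedDiv (hΦc : ∀ A : Dᵒᵖ, IsCancelMul (Φ.obj A)) :
    ∃ DivBpf : perfectionFunctor B ⟶ monoidGp (perfectionFunctor Φ), IsPerfectedDiv Φ B DivB DivBpf := by
  -- the target groups `P_A = (Φ^pf(A))^gp` are perfect: `P_A → P_A^pf` is bijective
  have hbij : ∀ A : Dᵒᵖ,
      Bijective (Perfection.of (Algebra.GrothendieckGroup ((perfectionFunctor Φ).obj A))) := fun A =>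
    isPerfect_iff_bijective_of.mp (isPerfect_gpPerfection (Φ.obj A))
  let e : ∀ A : Dᵒᵖ, Algebra.GrothendieckGroup ((perfectionFunctor Φ).obj A) ≃*
      Perfection (Algebra.GrothendieckGroup ((perfectionFunctor Φ).obj A)) := fun A =>
    MulEquiv.ofBijective (Perfection.of _) (hbij A)
  -- `ι^gp ∘ Div_B : B(A) → (Φ^pf(A))^gp`
  let g : ∀ A : Dᵒᵖ, B.obj A →* Algebra.GrothendieckGroup ((perfectionFunctor Φ).obj A) := fun A =>
    (gpApp (toPerfectionFunctor Φ) A).comp (divB Φ B DivB A)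
  -- `Div_B^pf` at `A`
  let d : ∀ A : Dᵒᵖ, (perfectionFunctor B).obj A →* Algebra.GrothendieckGroup ((perfectionFunctor Φ).obj A) :=
    fun A => (e A).symm.toMonoidHom.comp (Perfection.map (g A))
  have d_of : ∀ (A : Dᵒᵖ) (b : B.obj A), d A (Perfection.of (B.obj A) b) = g A b := fun A b =>
    (e A).symm_apply_apply (g A b)
  refine ⟨{ app := fun A => CommMonCat.ofHom (d A), naturality := ?_ }, ?_⟩
  · intro A A' f
    obtain ⟨Y⟩ := A
    obtain ⟨X⟩ := A'
    obtain ⟨f, rfl⟩ : ∃ g : X ⟶ Y, g.op = f := ⟨f.unop, rfl⟩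
    haveI := hΦc (op X)
    apply CommMonCat.hom_ext
    refine Perfection.hom_ext_gpPerfection (M := B.obj (op Y)) (N := Φ.obj (op X)) fun b => ?_
    change d (op X) (((perfectionFunctor B).map f.op).hom (Perfection.of _ b)) =
      pullGp (perfectionFunctor Φ) f (d (op Y) (Perfection.of _ b))
    rw [d_of, show ((perfectionFunctor B).map f.op).hom (Perfection.of _ b) = Perfection.of _ ((B.map f.op).hom b)
      from rfl, d_of]
    change gpApp (toPerfectionFunctor Φ) (op X) (divB Φ B DivB (op X) ((B.map f.op).hom b)) =
      pullGp (perfectionFunctor Φ) f (gpApp (toPerfectionFunctor Φ) (op Y) (divB Φ B DivB (op Y) b))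
    rw [← pullGp_divB, gpApp_pullGp]
  · apply NatTrans.ext
    funext A
    apply CommMonCat.hom_ext
    ext b
    exact d_of A b

/-- **The perfected divisor datum is unique**: any two `DivBpf` with `IsPerfectedDiv` coincide (both extend
`ι^gp ∘ Div_B` along `B → B^pf`, `Perfection.hom_ext_gpPerfection`).  [cite: MochizukiFrdI2008, Prop. 5.5 (iv) p.104] -/
theorem isPerfectedDiv_unique (hΦc : ∀ A : Dᵒᵖ, IsCancelMul (Φ.obj A))
    {DivBpf DivBpf' : perfectionFunctor B ⟶ monoidGp (perfectionFunctor Φ)}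
    (h : IsPerfectedDiv Φ B DivB DivBpf) (h' : IsPerfectedDiv Φ B DivB DivBpf') : DivBpf = DivBpf' := by
  apply NatTrans.ext
  funext A
  haveI := hΦc A
  apply CommMonCat.hom_ext
  refine Perfection.hom_ext_gpPerfection (M := B.obj A) (N := Φ.obj A) fun b => ?_
  exact (ModelFrobenioid.divB_toPerfectionFunctor h A b).trans (ModelFrobenioid.divB_toPerfectionFunctor h' A b).symm

end ModelData

end Literature.AlgebraicGeometry.Frobenioids
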